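import Summits.CriticalPhenomena.Ising3DConformalLimit.Theses.SynchronousCoupling

/-!
# Route `SynchronousCoupling` — vocabulary of the line `SketchIdeator2` (card `rate-from-dilations-splitting`)
for the crux `RotationJoining` (item stmt-CriticalPhenomena-18763)

This is the DEFINITIONS module of the line (no theorem of substance, nothing asserted): it carries, sorry-free,

* the readout vocabulary of the crux in named form — the integer matrix `A3 = 3T` of the commensurate rotation
  `T = A/3 ∈ SO(3) ∖ B₃`, the axis cell `axisCell n u = n(u + [0,1)³) ∩ ℤ³` (copy 2 of the crux), the tilted cell
  `tiltCell n m u = {x ∈ box | A x ∈ 3n(u + [0,1)³)}` (copy 1 of the crux, inside the crux's bookkeeping box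
  `Icc (-2n(m+1)) (2n(m+1))³`), the block sum `blockSum`, and the two self-normalisers `normAxis μ n`,
  `normTilt μ n m` (inverse `L²(μ)`-norms of the `u = 0` blocks) — all verbatim sub-terms of the route decl
  `Theses.SynchronousCoupling.RotationJoining`;
* the four statements of card C (`rate-from-dilations-splitting`, crux-ideate round 1, ideator 2):
  `DilationJoiningsAxis3` (the `p = 3` half of the route's crux `DilationJoinings`, stmt-18762, in this vocabulary),
  `DilationJoiningsTilted` (the same joining for tilted cells), `QualitativeRotationJoining` (the crux with
  `∀ ε > 0 ∃ N ∀ n ≥ N ∀ m … ≤ ε` in place of the power rate) and the transfer `RateBootstrap` ("the rate is free":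
  the three give the crux by gluing couplings along the scales `n, 3n, …, 3ʲn` and Minkowski in `L²` of the glued
  space), together with the rate-free, coupling-free `AsymptoticFDDIsotropy` and `SplittingTransfer` of the same card
  (the foreseen reshape `QualitativeRotationJoining ⇐ dilation joinings + FDD isotropy`);
* the registered stub STATEMENTS `Sig.stub_*` of the lead's skeleton `Cruxes/RotationJoining/Lines/SketchIdeator2.lean`
  (each a `def … : Prop`, to be PROVED by a helper file `Theorems/SynchronousCouplingRotationJoining<Stub>.lean`;
  nothing here claims them), and the bookkeeping sub-goal `Sig.stub_axis3OfDilationJoinings :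
  DilationJoinings → DilationJoiningsAxis3` linking the first stub to item stmt-18762.

Source of the statements: `Cruxes/RotationJoining/SketchIdeator2.lean` (planner-cruxidea-stmt-CriticalPhenomena-18763-2-0,
rc 0) — copied with the namespace changed (`…RateSplitting`) so that Theorems files can import them; the geometry
(`AᵀA = 9I`, `det A = 27`, every tilted cell has exactly `n³` lattice points, the box never truncates a cell since
`‖x‖₂ ≤ √3·n(m+1)`) is recorded in the item's grounder/refuter notes.
-/

namespace Summit.CriticalPhenomena.Ising3DConformalLimit.Cruxes.RotationJoining.RateSplitting

open MeasureTheory Literature.Probability.LatticeModels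

noncomputable section

/-! ## Readout vocabulary (verbatim sub-terms of the crux) -/

/-- `A = 3T`, `T` the rotation by `60°` about `[111]`; `AᵀA = 9I`, `det A = 27`, `A` is not a signed permutation
matrix (so `T ∉ B₃`). The crux writes this matrix inline as `!![(2:ℤ), 2, -1; -1, 2, 2; 2, -1, 2]`. -/
def A3 : Matrix (Fin 3) (Fin 3) ℤ := !![2, 2, -1; -1, 2, 2; 2, -1, 2]

/-- The axis cell `n(u + [0,1)³) ∩ ℤ³` (copy 2 of the crux): `∏ᵢ [n uᵢ, n uᵢ + n)`. -/
def axisCell (n : ℕ) (u : Fin 3 → ℤ) : Finset (Site 3) :=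
  Fintype.piFinset fun i => Finset.Ico ((n : ℤ) * u i) ((n : ℤ) * u i + (n : ℤ))

/-- The tilted cell `{x | A x ∈ 3n(u + [0,1)³)} = T⁻¹(n(u + [0,1)³)) ∩ ℤ³` inside the crux's bookkeeping box
`Icc (-2n(m+1)) (2n(m+1))³` (copy 1 of the crux; the box contains every cell with `|uᵢ| ≤ m`). -/
def tiltCell (n m : ℕ) (u : Fin 3 → ℤ) : Finset (Site 3) :=
  (Fintype.piFinset fun _ : Fin 3 =>
      Finset.Icc (-(2 * (n : ℤ) * ((m : ℤ) + 1))) (2 * (n : ℤ) * ((m : ℤ) + 1))).filter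
    fun x => ∀ i, 3 * (n : ℤ) * u i ≤ A3.mulVec x i ∧ A3.mulVec x i < 3 * (n : ℤ) * (u i + 1)

/-- The spin sum `∑_{x ∈ S} σ_x` over a finite cell. -/
def blockSum (S : Finset (Site 3)) (σ : SpinConfig (Site 3)) : ℝ := ∑ x ∈ S, spinAt x σ

/-- The crux's normaliser of copy 2: `(√(∫ (∑_{x ∈ axisCell n 0} σ_x)² dμ))⁻¹`. -/
def normAxis (μ : Measure (SpinConfig (Site 3))) (n : ℕ) : ℝ :=
  (Real.sqrt (∫ σ, (blockSum (axisCell n 0) σ) ^ 2 ∂μ))⁻¹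

/-- The crux's normaliser of copy 1: `(√(∫ (∑_{x ∈ tiltCell n m 0} σ_x)² dμ))⁻¹`. -/
def normTilt (μ : Measure (SpinConfig (Site 3))) (n m : ℕ) : ℝ :=
  (Real.sqrt (∫ σ, (blockSum (tiltCell n m 0) σ) ^ 2 ∂μ))⁻¹

/-! ## Card C — the rate is inherited from dilation joinings -/

/-- Dilation joinings for AXIS cells with `p = 3`: for every translation-invariant critical Gibbs measure `μ`
there are `C, θ > 0` such that for all `b ≥ 1`, `m` there is a coupling `π` of `μ` with `μ` under which, for every
block index `|uᵢ| ≤ m`, the self-normalised axis block of side `3b` at `u` (copy 1) and of side `b` at `u` (copy 2)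
differ by at most `C b^(-θ)` in `L²(π)`. This is the `p = 3` half of the route's crux `DilationJoinings`
(stmt-CriticalPhenomena-18762) in the vocabulary above (`Sig.stub_axis3OfDilationJoinings`). -/
def DilationJoiningsAxis3 : Prop :=
  ∀ μ ∈ isingGibbsMeasures 3 (criticalBeta 3) 0, IsTranslationInvariantMeasure μ →
    ∃ C θ : ℝ, 0 < θ ∧ ∀ b m : ℕ, 1 ≤ b →
      ∃ π : Measure (SpinConfig (Site 3) × SpinConfig (Site 3)), π.fst = μ ∧ π.snd = μ ∧
        ∀ u : Fin 3 → ℤ, (∀ i, |u i| ≤ m) →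
          ∫ q, (normAxis μ (3 * b) * blockSum (axisCell (3 * b) u) q.1
                  - normAxis μ b * blockSum (axisCell b u) q.2) ^ 2 ∂π ≤ C * (b : ℝ) ^ (-θ)

/-- Dilation joinings for the TILTED cells `T⁻¹(b(u + [0,1)³))` with `p = 3` (same shape as `DilationJoiningsAxis3`;
the tilted cell of side `3b` at `u` is the exact union of the 27 tilted cells of side `b` at `3u + v`, `v ∈ {0,1,2}³`,
because `A = 3T` is an integer matrix). -/
def DilationJoiningsTilted : Prop :=
  ∀ μ ∈ isingGibbsMeasures 3 (criticalBeta 3) 0, IsTranslationInvariantMeasure μ →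
    ∃ C θ : ℝ, 0 < θ ∧ ∀ b m : ℕ, 1 ≤ b →
      ∃ π : Measure (SpinConfig (Site 3) × SpinConfig (Site 3)), π.fst = μ ∧ π.snd = μ ∧
        ∀ u : Fin 3 → ℤ, (∀ i, |u i| ≤ m) →
          ∫ q, (normTilt μ (3 * b) m * blockSum (tiltCell (3 * b) m u) q.1
                  - normTilt μ b m * blockSum (tiltCell b m u) q.2) ^ 2 ∂π ≤ C * (b : ℝ) ^ (-θ)

/-- Qualitative, WINDOW-UNIFORM rotation joining: for every `ε > 0` there is a scale `N` such that for all `n ≥ N`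
and every window `m` some coupling of `μ` with `μ` has per-block tilted/axis `L²`-defect `≤ ε` for all `|uᵢ| ≤ m`
(the crux with its power rate `C n^(-θ)` replaced by `ε`; `N` does not depend on `m`). -/
def QualitativeRotationJoining : Prop :=
  ∀ μ ∈ isingGibbsMeasures 3 (criticalBeta 3) 0, IsTranslationInvariantMeasure μ →
    ∀ ε : ℝ, 0 < ε → ∃ N : ℕ, ∀ n m : ℕ, N ≤ n →
      ∃ π : Measure (SpinConfig (Site 3) × SpinConfig (Site 3)), π.fst = μ ∧ π.snd = μ ∧
        ∀ u : Fin 3 → ℤ, (∀ i, |u i| ≤ m) →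
          ∫ q, (normTilt μ n m * blockSum (tiltCell n m u) q.1
                  - normAxis μ n * blockSum (axisCell n u) q.2) ^ 2 ∂π ≤ ε

/-- **Card C, first lemma (rate bootstrap).** Dilation joinings for axis cells and for tilted cells plus a
qualitative window-uniform rotation joining give the crux `RotationJoining` WITH its power rate: for fixed `(n, m)`
glue the chain of couplings `tilt⁽ⁿ⁾ ~ tilt⁽³ⁿ⁾ ~ … ~ tilt⁽ᴺ⁾ ~ axis⁽ᴺ⁾ ~ … ~ axis⁽³ⁿ⁾ ~ axis⁽ⁿ⁾`, `N = 3ʲn ≥ N(ε)`,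
`ε = n^(-θ)`, along the shared copies of `μ` (disintegration on the standard Borel space `SpinConfig (Site 3)`);
by Minkowski in `L²` of the glued space the per-block defects add, and `Σᵢ (3ⁱn)^(-θ/2)` is geometric. A statement to
be PROVED (`Sig.stub_rateBootstrap`), not asserted here. -/
def RateBootstrap : Prop :=
  DilationJoiningsAxis3 → DilationJoiningsTilted → QualitativeRotationJoining →
    Summit.CriticalPhenomena.Ising3DConformalLimit.Theses.SynchronousCoupling.RotationJoining

/-- Rate-free, coupling-free, finite-window isotropy of the limiting block process: for every finite family of
block indices and every bounded `1`-Lipschitz test function, the expectations over tilted and over axis cells have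
the same limit as `n → ∞` (card C's `AsymptoticFDDIsotropy`; the embedding-sensitive content of the crux). -/
def AsymptoticFDDIsotropy : Prop :=
  ∀ μ ∈ isingGibbsMeasures 3 (criticalBeta 3) 0, IsTranslationInvariantMeasure μ →
    ∀ (j m : ℕ) (us : Fin j → (Fin 3 → ℤ)), (∀ i l, |us i l| ≤ m) →
      ∀ f : (Fin j → ℝ) → ℝ, LipschitzWith 1 f → (∃ B : ℝ, ∀ v, |f v| ≤ B) →
        Filter.Tendsto
          (fun n : ℕ =>
            (∫ σ, f (fun i => normTilt μ n m * blockSum (tiltCell n m (us i)) σ) ∂μ) -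
              ∫ σ, f (fun i => normAxis μ n * blockSum (axisCell n (us i)) σ) ∂μ)
          Filter.atTop (nhds 0)

/-- **Card C, transfer (foreseen reshape).** Dilation joinings for both cell shapes and `AsymptoticFDDIsotropy` give
the crux (glue the two infinite dilation chains by Ionescu-Tulcea, pass to the `L²`-limit block fields, identify
their finite-dimensional laws, glue along the common law). A statement, not asserted here. -/
def SplittingTransfer : Prop :=
  DilationJoiningsAxis3 → DilationJoiningsTilted → AsymptoticFDDIsotropy →
    Summit.CriticalPhenomena.Ising3DConformalLimit.Theses.SynchronousCoupling.RotationJoining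

/-! ## Registered stub statements of the line `SketchIdeator2` (skeleton `Cruxes/RotationJoining/Lines/SketchIdeator2.lean`)

`RotationJoining_of : Sig.stub_dilationJoiningsAxis3 → Sig.stub_dilationJoiningsTilted →
Sig.stub_qualitativeRotationJoining → Sig.stub_rateBootstrap → RotationJoining` is `fun h₁ h₂ h₃ h₄ => h₄ h₁ h₂ h₃`. -/

/-- Stub 1 (= `DilationJoiningsAxis3`; follows from item stmt-CriticalPhenomena-18762 by
`Sig.stub_axis3OfDilationJoinings`). -/
def Sig.stub_dilationJoiningsAxis3 : Prop := DilationJoiningsAxis3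

/-- Stub 2 (= `DilationJoiningsTilted`). -/
def Sig.stub_dilationJoiningsTilted : Prop := DilationJoiningsTilted

/-- Stub 3 (= `QualitativeRotationJoining`). -/
def Sig.stub_qualitativeRotationJoining : Prop := QualitativeRotationJoining

/-- Stub 4 (= `RateBootstrap`, the transfer; provable now by gluing). -/
def Sig.stub_rateBootstrap : Prop := RateBootstrap

/-- Bookkeeping sub-goal: the route's crux `DilationJoinings` (stmt-CriticalPhenomena-18762, `p ∈ {2,3}`) gives
`DilationJoiningsAxis3` (its `p = 3` instance, with `((3 * b : ℕ) : ℤ) = 3 * b` and `axisCell n 0 = [0,n)³`). -/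
def Sig.stub_axis3OfDilationJoinings : Prop :=
  Summit.CriticalPhenomena.Ising3DConformalLimit.Theses.SynchronousCoupling.DilationJoinings → DilationJoiningsAxis3

/-- Foreseen-reshape sub-goal: the qualitative joining from the two dilation joinings and FDD isotropy
(card C's `SplittingTransfer` with conclusion `QualitativeRotationJoining`; with `Sig.stub_rateBootstrap` it gives
`SplittingTransfer`). -/
def Sig.stub_qualitativeOfFDDIsotropy : Prop :=
  DilationJoiningsAxis3 → DilationJoiningsTilted → AsymptoticFDDIsotropy → QualitativeRotationJoining

/-- Reshape 1 (cycle 1) of the line: the former stub 3 `QualitativeRotationJoining` is split into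
`Sig.stub_asymptoticFDDIsotropy` (= `AsymptoticFDDIsotropy`, the rate-free, coupling-free open content) and
`Sig.stub_qualitativeOfFDDIsotropy` (the transfer). Stub 3a of the reshaped skeleton. -/
def Sig.stub_asymptoticFDDIsotropy : Prop := AsymptoticFDDIsotropy

/-- Certificate of the reshape (registered glue sub-goal `stub_qualitativeOfFDDIsotropy_iff`): the transfer stub is, by
`Iff.rfl`, "the two dilation joinings and the new stub 3a give the former stub 3". -/
theorem stub_qualitativeOfFDDIsotropy_iff :
    Sig.stub_qualitativeOfFDDIsotropy ↔
      (Sig.stub_dilationJoiningsAxis3 → Sig.stub_dilationJoiningsTilted → Sig.stub_asymptoticFDDIsotropy →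
        Sig.stub_qualitativeRotationJoining) :=
  Iff.rfl

end

end Summit.CriticalPhenomena.Ising3DConformalLimit.Cruxes.RotationJoining.RateSplitting
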